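import Summits.QuantumFields.YangMills.Theorems.GronwallGapAnalyticDetourReduction

/-!
# Crux `AnalyticDetour` (stmt-QuantumFields-8801), line `registered`:
# the cut is EXACT — the crux is equivalent to its open core (the anchored detour)

Route `GronwallGap`, sub-problem `YangMills`.  The landed reduction
`stub_reductionToAnchoredDetour` (file `GronwallGapAnalyticDetourReduction.lean`) proves
`stub_anchoredDetour → AnalyticDetour` by concatenation with the strong-coupling window.  This
file proves the CONVERSE, `AnalyticDetour → stub_anchoredDetour` (anchor `βa := min b β₁ / 2`,
which lies both in `(0, b)` and in the crux's window `(0, β₁)`), and records the equivalence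
`AnalyticDetour ↔ stub_anchoredDetour`.  Consequence for the line: promoting the one open stub to
an item loses nothing and gains nothing — the stub IS the crux up to a proved equivalence; every
proof or refutation of either transfers verbatim to the other.

Pure logic on the registered statements; no named facts; no definitions.
-/

noncomputable section

namespace Summit.QuantumFields.YangMills.Theorems

open scoped BigOperators

/-- **Exactness of the cut, converse direction.**  The route decl
`Summit.QuantumFields.YangMills.Theses.GronwallGap.AnalyticDetour` implies the anchored-detour
statement (`stub_anchoredDetour` of the skeleton, verbatim as registered on the ledger): given the
crux's `E`, `β₁` for `(G, r)` and any depth `b > 0`, the anchor `βa := min b β₁ / 2` lies in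
`(0, b) ∩ (0, β₁)`, so the crux's own path from the start `βs := βa` to `β ∉ E` is the witness. -/
theorem anchoredDetour_of_analyticDetour :
    Summit.QuantumFields.YangMills.Theses.GronwallGap.AnalyticDetour →
    (∀ (G : Type) [Group G] [TopologicalSpace G] [IsTopologicalGroup G] [CompactSpace G], Literature.MathematicalPhysics.QuantumFieldTheory.IsCompactSimpleLieGroup G → letI : MeasurableSpace G := borel G; haveI : BorelSpace G := ⟨rfl⟩; let Pseq : (G → ℝ) → ℕ → ℝ := fun v L => (((L + 1 : ℕ) : ℝ) ^ 4)⁻¹ * Real.log (((MeasureTheory.Measure.pi fun _ : Literature.MathematicalPhysics.QuantumFieldTheory.Edge 4 (L + 1) => Literature.MathematicalPhysics.QuantumFieldTheory.haarProbability G).withDensity (fun U : Literature.MathematicalPhysics.QuantumFieldTheory.GaugeConfig 4 (L + 1) G => ENNReal.ofReal (Literature.MathematicalPhysics.QuantumLattice.groupHeatKernelWeight (fun _ : ℝ => v) 0 U))) Set.univ).toReal; let AnP : (G → ℝ) → Prop := fun v => ∀ φ : G → ℝ, Continuous φ → (∀ g h : G, φ (h * g * h⁻¹) = φ g) → ∃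 p : ℝ → ℝ, (∀ t : ℝ, Filter.Tendsto (fun L : ℕ => Pseq (fun g => v g * Real.exp (t * φ g)) L) Filter.atTop (nhds (p t))) ∧ AnalyticAt ℝ p 0; let Adm : (ℝ → G → ℝ) → Prop := fun w => (∀ s ∈ Set.Icc (0 : ℝ) 1, Continuous (w s) ∧ (∀ g : G, 0 < w s g) ∧ (∀ g h : G, w s (h * g * h⁻¹) = w s g) ∧ (∀ g : G, w s g⁻¹ = w s g) ∧ (∀ (n : ℕ) (x : Fin n → G) (c : Fin n → ℂ), 0 ≤ (∑ i, ∑ j, (starRingEnd ℂ) (c i) * c j * ((w s ((x i)⁻¹ * x j) : ℝ) : ℂ)).re)) ∧ ∃ Λ : ℝ, ∀ s ∈ Set.Icc (0 : ℝ) 1, ∀ s' ∈ Set.Icc (0 : ℝ) 1, ∀ g : G, |Real.log (w s g) - Real.log (w s' g)| ≤ Λ * |s - s'|; ∀ r : Literature.MathematicalPhysics.QuantumFieldTheory.LatticeRep G, ∃ E : Set ℝ, (∀ b : ℝ, (E ∩ Set.Icc 0 b).Finite) ∧ ∀ b : ℝ, 0 < b → ∃ βa ∈ Set.Ioo (0 :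 ℝ) b, ∀ β : ℝ, 0 < β → β ∉ E → ∃ w : ℝ → G → ℝ, Adm w ∧ (∀ s ∈ Set.Icc (0 : ℝ) 1, AnP (w s)) ∧ w 0 = (fun g => Real.exp (βa * (r.ρ g).trace.re)) ∧ w 1 = (fun g => Real.exp (β * (r.ρ g).trace.re))) := by
  intro h G i1 i2 i3 i4 hG Pseq AnP Adm r
  obtain ⟨E, hE, β₁, hβ₁, hpath⟩ := h G hG r
  refine ⟨E, hE, fun b hb => ⟨min b β₁ / 2, ⟨by positivity, ?_⟩, fun β hβ hβE => ?_⟩⟩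
  · have hmin : min b β₁ ≤ b := min_le_left _ _
    linarith
  · have hmin : min b β₁ ≤ β₁ := min_le_right _ _
    exact hpath β hβ hβE (min b β₁ / 2) ⟨by positivity, by linarith⟩

/-- **The crux is equivalent to its open core.**  `AnalyticDetour ↔ stub_anchoredDetour`
(registered on the ledger as `stub_cutExact`): `→` is `anchoredDetour_of_analyticDetour`, `←` is the landed reduction
`stub_reductionToAnchoredDetour` (concatenation with the strong-coupling window theorem
`stub_strongCouplingWindow`). -/
theorem stub_cutExact :
    Summit.QuantumFields.YangMills.Theses.GronwallGap.AnalyticDetour ↔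
    (∀ (G : Type) [Group G] [TopologicalSpace G] [IsTopologicalGroup G] [CompactSpace G], Literature.MathematicalPhysics.QuantumFieldTheory.IsCompactSimpleLieGroup G → letI : MeasurableSpace G := borel G; haveI : BorelSpace G := ⟨rfl⟩; let Pseq : (G → ℝ) → ℕ → ℝ := fun v L => (((L + 1 : ℕ) : ℝ) ^ 4)⁻¹ * Real.log (((MeasureTheory.Measure.pi fun _ : Literature.MathematicalPhysics.QuantumFieldTheory.Edge 4 (L + 1) => Literature.MathematicalPhysics.QuantumFieldTheory.haarProbability G).withDensity (fun U : Literature.MathematicalPhysics.QuantumFieldTheory.GaugeConfig 4 (L + 1) G => ENNReal.ofReal (Literature.MathematicalPhysics.QuantumLattice.groupHeatKernelWeight (fun _ : ℝ => v) 0 U))) Set.univ).toReal; let AnP : (G → ℝ) → Prop := fun v => ∀ φ : G → ℝ, Continuous φ → (∀ g h : G, φ (h * g * h⁻¹) = φ g) → ∃ p : ℝ → ℝ, (∀ t : ℝ, Filter.Tendsto (fun L : ℕ => Pseq (fun g => v g * Real.exp (t * φ g)) L) Filter.atTop (nhds (p t))) ∧ AnalyticAt ℝ p 0; let Adm : (ℝ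 → G → ℝ) → Prop := fun w => (∀ s ∈ Set.Icc (0 : ℝ) 1, Continuous (w s) ∧ (∀ g : G, 0 < w s g) ∧ (∀ g h : G, w s (h * g * h⁻¹) = w s g) ∧ (∀ g : G, w s g⁻¹ = w s g) ∧ (∀ (n : ℕ) (x : Fin n → G) (c : Fin n → ℂ), 0 ≤ (∑ i, ∑ j, (starRingEnd ℂ) (c i) * c j * ((w s ((x i)⁻¹ * x j) : ℝ) : ℂ)).re)) ∧ ∃ Λ : ℝ, ∀ s ∈ Set.Icc (0 : ℝ) 1, ∀ s' ∈ Set.Icc (0 : ℝ) 1, ∀ g : G, |Real.log (w s g) - Real.log (w s' g)| ≤ Λ * |s - s'|; ∀ r : Literature.MathematicalPhysics.QuantumFieldTheory.LatticeRep G, ∃ E : Set ℝ, (∀ b : ℝ, (E ∩ Set.Icc 0 b).Finite) ∧ ∀ b : ℝ, 0 < b → ∃ βa ∈ Set.Ioo (0 : ℝ) b, ∀ β : ℝ, 0 < β → β ∉ E → ∃ w : ℝ → G → ℝ, Adm w ∧ (∀ s ∈ Set.Icc (0 : ℝ) 1, AnP (w s)) ∧ w 0 = (fun g => Real.exp (βa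 * (r.ρ g).trace.re)) ∧ w 1 = (fun g => Real.exp (β * (r.ρ g).trace.re))) :=
  ⟨anchoredDetour_of_analyticDetour, stub_reductionToAnchoredDetour⟩

end Summit.QuantumFields.YangMills.Theorems

end
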